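import Summits.ABC.IUTFork.Joshi.ThetaValuesLocusPeriodTower
import Summits.ABC.IUTFork.Joshi.LocalPeriodRings
import HarnessLib

/-!
# The [J-III] §5 period-ring tower SUPPLIES the [J-IIp] §8.5 tower: `ATS3.PeriodRingTower D p Ω ⟶ D.PeriodTower B_cris B_dR B_dR`,
# and Prop. 8.5.1 read through E-t9's embedding `B ↪ B_dR` — BRIDGE, proof/defs-light

Companion (junction / R12 carrier reconciliation) of the abc-iut cell, block E «type Joshi's construction, test vs S» (rung
LADDER-ABC:A2.E; seat abc-iut-E-t50, typer-side second reader of p436208, reader-companion rule of the END-GAME BOOK) to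
`Joshi/ThetaValuesLocusPeriodTower.lean` (E-t3, p436208: the HYPOTHESIS structure `PeriodRingDatum.PeriodTower` = the cited
input «`B⁺ ⊂ B_cris ⊂ B_st ⊂ B_dR` [Fargues–Fontaine 2018], [Fontaine 1994b]» of K. Joshi, arXiv:2303.01662v3 ([J-IIp], bib
`Joshi2023ATS2Local`) Prop. 8.5.1, p. 25 l. 1–8 of the cell render `HOME/lit/renders/Joshi-arxiv-2303.01662/p0025.txt`, and
the DERIVED `PrototypeDatum.prop851`) and `Joshi/LocalPeriodRings.lean` (E-t9, p431480: the HYPOTHESIS structure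
`ATS3.PeriodRingTower D p Ω` = K. Joshi, arXiv:2401.13508v4 ([J-III], bib `Joshi2024ATS3`) §5.1–§5.2, p. 38 l. 25 – p. 40
l. 37: `B ↪ B_dR = Ω` (5.2.4.2), `B⁺ ⊂ B⁺_cris ⊂ B_cris = B⁺_cris[1/t] ⊂ B_dR` (5.2.6.2)). Both towers sit over the SAME
period-ring signature `D : PeriodRingDatum` of `Joshi/ThetaValuesLocus.lean` (E-t3); this file records, in kernel, that the
second supplies the first, so that the two typings of «the inclusions of [FF18]» are not parallel carriers. Nothing of
either parent is restated: `Bcrisplus_le_Bcris`, `toBdR_mem_Bcris_of_mem_Bplus` (E-t9) and `thetaLocus_subset_Bplus`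
(= [J-IIp] Lemma 8.4.1, E-t3) are consumed BY NAME. FRAMING as in the parents: objects of UNREFEREED preprints typed as
signatures; typed ≠ proved; typed AS A CANDIDATE ≠ endorsed; NO SIDE taken on [IUTchIII] Cor. 3.12 or on any author
(Mochizuki / Scholze–Stix / Joshi); the campaign locates / conditionally verifies; no abc claim; `S =
Cor312Vol.PilotKummerIndRelated` is not mentioned (no Cor312*/Thm311* import, E-PLAN R14).

WHAT IS HERE. (A) `ATS3.PeriodRingTower.toPeriodTower T : D.PeriodTower ↥T.Bcris Ω Ω` — `B_cris :=` E-t9's crystalline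
subalgebra of `Ω = B_dR`, `B_st := B_dR := Ω` ([J-III] §5 carries no semistable ring; the middle term of Prop. 8.5.1 is
instantiated DEGENERATELY as `B_dR` itself with the identity `B_st → B_dR` — the injectivity content of Prop. 8.5.1 is
unchanged, the semistable refinement is simply not supplied by [J-III] §5), `ofBplus x := toBdR x ∈ B_cris` whenever
`toBdR x ∈ B_cris` (in particular on `B⁺`, via `B⁺ ↪ B⁺_cris ≤ B_cris`), junk `0` otherwise; NO side condition is needed
(membership is tested on the `B_dR` side, where `B_cris` is a subring). (B) DERIVED: through this junction the [J-IIp]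
coordinatewise map `toDR` IS E-t9's embedding `toBdR` applied coordinatewise on `Θ̃` (`toDR_toPeriodTower`), the image
`thetaLocusDR` is `(toBdR)^{ℓ⋆} '' Θ̃` (`thetaLocusDR_toPeriodTower`), and Prop. 8.5.1 AS TYPED holds over every [J-III] §5
tower (`prop851_toPeriodTower`) — «Prop. 8.5.1 follows from Joshi's [J-III] §5 inputs AS TYPED», nothing more. (C) CONTENT
CENSUS (located observation, no claim about print): `PeriodRingDatum.trivialTower D : D.PeriodTower B B B` — the
hypothesis structure of p436208 is inhabited over EVERY `D` by identity maps, so `prop851` retains no arithmetic of the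
period rings beyond Lemma 8.4.1 (as p436208's own docstring says: «nothing is instantiated»). Style rules as in the parents
(no notation / axiom / `sorry` / instance; nothing asserted). bears_on: LADDER-ABC:A2.E.
-/

noncomputable section

open Set

namespace Summit.ABC.IUTFork.Joshi

/-! ## A. The junction `ATS3.PeriodRingTower ⟶ PeriodRingDatum.PeriodTower` -/

namespace ATS3.PeriodRingTower

variable {F B E0 : Type} [Field F] [CommRing B] [Field E0] {Y : Type} {K : Y → Type} [∀ y, Field (K y)] {G : Type}
  [Group G] {D : PeriodRingDatum F B E0 Y K G} {p : ℕ} [Fact p.Prime] [Algebra ℚ_[p] B] {Ω : Type} [Field Ω]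
  [Algebra ℚ_[p] Ω] (T : PeriodRingTower D p Ω)

open Classical in
/-- The map `B → B_cris` underlying the junction: `x ↦ toBdR x` regarded in E-t9's `B_cris ⊂ B_dR` whenever it lies there
(always the case on `B⁺`, [J-III] (5.2.6.2) `B⁺ ↪ B⁺_cris ⊂ B_cris`), junk `0` otherwise. [bridge] -/
def ofBplusCris (x : B) : T.Bcris :=
  if h : T.toBdR x ∈ T.Bcris then ⟨T.toBdR x, h⟩ else 0

/-- On elements whose image lies in `B_cris` the junction map is `toBdR` (as an element of `B_cris`). [bridge] -/
theorem ofBplusCris_of_mem {x : B} (h : T.toBdR x ∈ T.Bcris) : T.ofBplusCris x = ⟨T.toBdR x, h⟩ := by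
  rw [ofBplusCris, dif_pos h]

/-- … in particular on `B⁺` its value in `B_dR` is `toBdR x`. [bridge] -/
theorem coe_ofBplusCris {x : B} (hx : x ∈ D.Bplus) : (T.ofBplusCris x : Ω) = T.toBdR x := by
  rw [T.ofBplusCris_of_mem (T.toBdR_mem_Bcris_of_mem_Bplus hx)]

/-- **JUNCTION.** Every [J-III] §5 tower `B ↪ B_dR`, `B⁺ ⊂ B⁺_cris ⊂ B_cris ⊂ B_dR` (E-t9's `ATS3.PeriodRingTower D p Ω`)
supplies the [J-IIp] §8.5 hypothesis structure of p436208 with `B_cris := ↥T.Bcris`, `B_st := B_dR := Ω` (degenerate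
semistable term, see the module docstring), `B⁺ → B_cris` the junction map, `B_cris ↪ B_st` the subalgebra inclusion and
`B_st ↪ B_dR` the identity. No side condition. [bridge] -/
def toPeriodTower : D.PeriodTower T.Bcris Ω Ω where
  ofBplus := T.ofBplusCris
  ofBplus_zero := by
    rw [T.ofBplusCris_of_mem (by rw [map_zero]; exact zero_mem _)]
    exact Subtype.ext (map_zero _)
  ofBplus_one := by
    rw [T.ofBplusCris_of_mem (by rw [map_one]; exact one_mem _)]
    exact Subtype.ext (map_one _)
  ofBplus_add x hx y hy := by
    have hx' := T.toBdR_mem_Bcris_of_mem_Bplus hx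
    have hy' := T.toBdR_mem_Bcris_of_mem_Bplus hy
    rw [T.ofBplusCris_of_mem hx', T.ofBplusCris_of_mem hy',
      T.ofBplusCris_of_mem (by rw [map_add]; exact add_mem hx' hy')]
    exact Subtype.ext (map_add _ _ _)
  ofBplus_mul x hx y hy := by
    have hx' := T.toBdR_mem_Bcris_of_mem_Bplus hx
    have hy' := T.toBdR_mem_Bcris_of_mem_Bplus hy
    rw [T.ofBplusCris_of_mem hx', T.ofBplusCris_of_mem hy',
      T.ofBplusCris_of_mem (by rw [map_mul]; exact mul_mem hx' hy')]
    exact Subtype.ext (map_mul _ _ _)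
  injOn_ofBplus x hx y hy h := by
    have h' := congr_arg (fun z : T.Bcris => (z : Ω)) h
    simp only [T.coe_ofBplusCris hx, T.coe_ofBplusCris hy] at h'
    exact T.toBdR_injective h'
  crisToSt := T.Bcris.val.toRingHom
  crisToSt_injective := Subtype.val_injective
  stToDR := RingHom.id Ω
  stToDR_injective := Function.injective_id

/-- The junction's `B⁺ → B_cris` is the junction map. [bridge] -/
theorem toPeriodTower_ofBplus (x : B) : T.toPeriodTower.ofBplus x = T.ofBplusCris x := rfl

/-- The junction's `B_cris ↪ B_st = B_dR` is the subalgebra inclusion. [bridge] -/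
theorem toPeriodTower_crisToSt (z : T.Bcris) : T.toPeriodTower.crisToSt z = (z : Ω) := rfl

/-- The junction's `B_st ↪ B_dR` is the identity of `Ω`. [bridge] -/
theorem toPeriodTower_stToDR (w : Ω) : T.toPeriodTower.stToDR w = w := rfl

end ATS3.PeriodRingTower

/-! ## B. Prop. 8.5.1 read through the junction: `Θ̃ ⊂ B_dR^{ℓ⋆}` is `toBdR` coordinatewise -/

namespace PrototypeDatum

variable {F B E0 : Type} [Field F] [CommRing B] [Field E0] {Y : Type} {K : Y → Type} [∀ y, Field (K y)] {G : Type}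
  [Group G] (P : PrototypeDatum F B E0 Y K G) {p : ℕ} [Fact p.Prime] [Algebra ℚ_[p] B] {Ω : Type} [Field Ω]
  [Algebra ℚ_[p] Ω] (T : ATS3.PeriodRingTower P.toPeriodRingDatum p Ω)

/-- Through the junction, the [J-IIp] coordinatewise map `Θ̃ → B_dR^{ℓ⋆}` of p436208 IS E-t9's embedding `B ↪ B_dR`
applied coordinatewise (on `Θ̃ ⊂ (B⁺)^{ℓ⋆}`, [J-IIp] Lemma 8.4.1 = `thetaLocus_subset_Bplus`). DERIVED. [bridge] -/
theorem toDR_toPeriodTower {z : Fin P.lstar → B} (hz : z ∈ P.thetaLocus) :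
    P.toDR T.toPeriodTower z = fun i => T.toBdR (z i) := by
  funext i
  exact T.coe_ofBplusCris (P.thetaLocus_subset_Bplus z hz i)

/-- The same on `(B⁺)^{ℓ⋆}`. [bridge] -/
theorem toDR_toPeriodTower_of_mem_Bplus {z : Fin P.lstar → B} (hz : ∀ i, z i ∈ P.Bplus) :
    P.toDR T.toPeriodTower z = fun i => T.toBdR (z i) := by
  funext i
  exact T.coe_ofBplusCris (hz i)

/-- Hence `Θ̃ ⊂ B_dR^{ℓ⋆}` (p436208's `thetaLocusDR`) is, over a [J-III] §5 tower, the image of `Θ̃` under `(toBdR)^{ℓ⋆}`.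
DERIVED. [bridge] -/
theorem thetaLocusDR_toPeriodTower :
    P.thetaLocusDR T.toPeriodTower = (fun z i => T.toBdR (z i)) '' P.thetaLocus :=
  Set.image_congr fun _ hz => P.toDR_toPeriodTower T hz

/-- … and `(toBdR)^{ℓ⋆}` is injective on all of `B^{ℓ⋆}` (E-t9's `toBdR_injective`), a fortiori on `Θ̃`. [bridge] -/
theorem injective_pi_toBdR : Function.Injective fun (z : Fin P.lstar → B) i => T.toBdR (z i) :=
  fun _ _ h => funext fun i => T.toBdR_injective (congr_fun h i)

/-- **Prop. 8.5.1 AS TYPED holds over every [J-III] §5 period-ring tower** (the junction + p436208's `prop851`): «Prop. 8.5.1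
follows from Joshi's [J-III] §5 inputs AS TYPED», nothing more. [claim: Joshi2023ATS2Local, status: disputed] -/
theorem prop851_toPeriodTower : P.Prop851 T.toPeriodTower := P.prop851 _

end PrototypeDatum

/-! ## C. Content census: the trivial tower -/

namespace PeriodRingDatum

variable {F B E0 : Type} [Field F] [CommRing B] [Field E0] {Y : Type} {K : Y → Type} [∀ y, Field (K y)] {G : Type}
  (D : PeriodRingDatum F B E0 Y K G)

/-- **CONTENT CENSUS.** The hypothesis structure `PeriodTower` of p436208 is inhabited over EVERY period-ring signature `D`
by the trivial tower `B_cris = B_st = B_dR := B` with identity maps: it retains no arithmetic of the period rings (located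
observation; p436208's docstring: «None of these rings is constructed here … nothing is instantiated»). [bridge] -/
def trivialTower : D.PeriodTower B B B where
  ofBplus := id
  ofBplus_zero := rfl
  ofBplus_one := rfl
  ofBplus_add _ _ _ _ := rfl
  ofBplus_mul _ _ _ _ := rfl
  injOn_ofBplus := Set.injOn_id _
  crisToSt := RingHom.id B
  crisToSt_injective := Function.injective_id
  stToDR := RingHom.id B
  stToDR_injective := Function.injective_id

end PeriodRingDatum

namespace PrototypeDatum

variable {F B E0 : Type} [Field F] [CommRing B] [Field E0] {Y : Type} {K : Y → Type} [∀ y, Field (K y)] {G : Type}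
  (P : PrototypeDatum F B E0 Y K G)

/-- Over the trivial tower the coordinatewise map `B^{ℓ⋆} → B_dR^{ℓ⋆}` is the identity. [bridge] -/
theorem toDR_trivialTower : P.toDR P.trivialTower = id := funext fun _ => rfl

/-- Over the trivial tower `Θ̃ ⊂ B_dR^{ℓ⋆}` is `Θ̃` itself. [bridge] -/
theorem thetaLocusDR_trivialTower : P.thetaLocusDR P.trivialTower = P.thetaLocus := by
  rw [PrototypeDatum.thetaLocusDR, toDR_trivialTower, Set.image_id]

/-- … and Prop. 8.5.1 AS TYPED holds there too (so it constrains no model of `D`). [bridge] -/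
theorem prop851_trivialTower : P.Prop851 P.trivialTower := P.prop851 _

end PrototypeDatum

end Summit.ABC.IUTFork.Joshi

end
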